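import Mathlib
import HarnessLib
import Summits.Ventures.LatticeQCDFlow.Scaling.IdentityFlowAcceptanceDiagonalLimit
import Summits.Ventures.LatticeQCDFlow.Scaling.HeterogeneousRowCLT

/-!
# LatticeQCDFlow / Scaling — LOG-NORMAL UNIVERSALITY for HETEROGENEOUS factorised flow samplers:
# independent, non-identical bounded blocks with `V⁻¹Σᵢ Var h_{V,i} → σ²` give
# `acc_V → ∫∫ min(e^x, e^y) dN(−s/2, s)²`, `s = c²σ²`

HONEST FRAMING: exact (Metropolis-corrected) sampling algorithms for lattice gauge theory;
figures of merit are autocorrelation/cost numbers at stated couplings and volumes; no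
continuum-physics claim.

Venture `LatticeQCDFlow` (cell pub-lqcd), topic `Scaling`; FANOUT row 3 (`s0-u1-a`, S0-B
implementation A, GEN-19).  NEW WORK of the cell (row 3's heterogeneous row CLT
`Scaling/HeterogeneousRowCLT` + the plumbing of `Scaling/IdentityFlowAcceptanceDiagonalLimit` +
Hoeffding block by block + the real product lemma for the partition function); NO definition is
introduced; nothing is cited.  It removes the last homogeneity assumption of row 3's universality
theorem (`Scaling/LogNormalUniversality`): the blocks of a row may have DIFFERENT laws `ρ_{V,i}` and
statistics `h_{V,i}` (boundary plaquettes, anisotropic couplings, mixed block types); only the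
average variance `V⁻¹Σᵢ Var h_{V,i} → σ²` enters the limiting log-weight law, and the acceptance
converges to the same log-normal law **`heteroPi_meanAccept_tendsto`**.

NOT CLAIMED: unbounded or dependent blocks; rates; any value at the cell's `(β, L)`.
-/

noncomputable section

namespace Summit.Ventures.LatticeQCDFlow.Theory2

open MeasureTheory ProbabilityTheory Filter Finset Real Set
open scoped Topology NNReal
open Literature.Probability.Distributions.PseudoMarginalNoise

/-! ## §1 Heterogeneous rows: bookkeeping -/

section HeteroRows

variable {Y : Type*} {mY : MeasurableSpace Y}

/-- The normalised heterogeneous row sum of bounded blocks is bounded by `√n·K`. [ours] -/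
theorem heteroPi_inv_sqrt_mul_sum_mem_Icc {n : ℕ} {h : Fin n → Y → ℝ} {K : ℝ}
    (hK : ∀ i y, |h i y| ≤ K) (y : Fin n → Y) :
    (Real.sqrt n)⁻¹ * ∑ i, h i (y i) ∈ Set.Icc (-(Real.sqrt n * K)) (Real.sqrt n * K) := by
  have hs : |∑ i, h i (y i)| ≤ n * K := by
    calc |∑ i, h i (y i)| ≤ ∑ i, |h i (y i)| := Finset.abs_sum_le_sum_abs _ _
      _ ≤ ∑ _i : Fin n, K := Finset.sum_le_sum fun i _ => hK i _
      _ = n * K := by simp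
  have hn0 : 0 ≤ Real.sqrt n := Real.sqrt_nonneg _
  have key : |(Real.sqrt n)⁻¹ * ∑ i, h i (y i)| ≤ Real.sqrt n * K := by
    rw [abs_mul, abs_of_nonneg (inv_nonneg.2 hn0)]
    rcases Nat.eq_zero_or_pos n with hn | hn
    · subst hn; simp
    · have hsn : 0 < Real.sqrt n := Real.sqrt_pos.2 (Nat.cast_pos.2 hn)
      rw [inv_mul_le_iff₀ hsn, ← mul_assoc, Real.mul_self_sqrt (Nat.cast_nonneg n)]
      exact hs
  exact abs_le.1 key

/-- `∫ e^{tΣᵢ hᵢ(yᵢ)} d(⊗ρᵢ) = ∏ᵢ Mᵢ(t)` for independent blocks. [ours] -/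
theorem heteroPi_integral_exp_mul_sum {n : ℕ} (ρ : Fin n → Measure Y) [∀ i, IsProbabilityMeasure (ρ i)]
    {h : Fin n → Y → ℝ} (hm : ∀ i, Measurable (h i)) (t : ℝ) :
    ∫ y, Real.exp (t * ∑ i, h i (y i)) ∂(Measure.pi ρ) = ∏ i, mgf (h i) (ρ i) t := by
  have hind : iIndepFun (fun (i : Fin n) (y : Fin n → Y) => h i (y i)) (Measure.pi ρ) :=
    iIndepFun_pi fun i => (hm i).aemeasurable
  have hs := hind.mgf_sum (fun i => (hm i).comp (measurable_pi_apply i)) Finset.univ (t := t)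
  have e : (∑ i ∈ (Finset.univ : Finset (Fin n)), fun y : Fin n → Y => h i (y i)) = fun y => ∑ i, h i (y i) := by
    funext y; simp [Finset.sum_apply]
  rw [e] at hs
  have hmarg : ∀ i : Fin n, mgf (fun y : Fin n → Y => h i (y i)) (Measure.pi ρ) t = mgf (h i) (ρ i) t :=
    fun i => by
    have hlaw := (measurePreserving_eval ρ i).map_eq
    have hm' := mgf_map (μ := Measure.pi ρ) (Y := Function.eval i) (X := h i)
      (measurable_pi_apply i).aemeasurable (t := t)
      (by rw [hlaw]; exact (Real.measurable_exp.comp (measurable_const.mul (hm i))).aestronglyMeasurable)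
    rw [hlaw] at hm'
    rw [hm']
    rfl
  simp only [hmarg] at hs
  rw [← hs]
  rfl

/-- Exponential moments of the law of the normalised heterogeneous row sum. [ours] -/
theorem heteroPi_integral_exp_mul_map_inv_sqrt_mul_sum {n : ℕ} (ρ : Fin n → Measure Y)
    [∀ i, IsProbabilityMeasure (ρ i)] {h : Fin n → Y → ℝ} (hm : ∀ i, Measurable (h i)) (t : ℝ) :
    ∫ u, Real.exp (t * u) ∂((Measure.pi ρ).map (fun y : Fin n → Y => (Real.sqrt n)⁻¹ * ∑ i, h i (y i)))
      = ∏ i, mgf (h i) (ρ i) (t / Real.sqrt n) := by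
  have hSm : Measurable fun y : Fin n → Y => (Real.sqrt n)⁻¹ * ∑ i, h i (y i) :=
    (Finset.measurable_sum _ fun i _ => (hm i).comp (measurable_pi_apply i)).const_mul _
  rw [integral_map hSm.aemeasurable (by fun_prop), ← heteroPi_integral_exp_mul_sum ρ hm (t / Real.sqrt n)]
  refine integral_congr_ae (Filter.Eventually.of_forall fun y => ?_)
  simp only
  congr 1
  ring

/-- Hoeffding, block by block: `∏ᵢ Mᵢ(c/√n) ≤ exp(2K²c²)` (crudely) for bounded centred blocks.
[ours] -/
theorem heteroPi_prod_mgf_div_sqrt_le {n : ℕ} (ρ : Fin n → Measure Y) [∀ i, IsProbabilityMeasure (ρ i)]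
    {h : Fin n → Y → ℝ} (hm : ∀ i, Measurable (h i)) {K : ℝ} (hK : ∀ i y, |h i y| ≤ K)
    (h0 : ∀ i, ∫ y, h i y ∂ρ i = 0) (c : ℝ) :
    ∏ i, mgf (h i) (ρ i) (c / Real.sqrt n) ≤ Real.exp ((‖K - -K‖₊ / 2) ^ 2 * c ^ 2 / 2) := by
  rcases Nat.eq_zero_or_pos n with hn | hn
  · subst hn; simp only [Finset.univ_eq_empty, Finset.prod_empty]; exact Real.one_le_exp (by positivity)
  have hb : ∀ i, ∀ᵐ y ∂ρ i, h i y ∈ Set.Icc (-K) K := fun i => ae_of_all _ fun y => abs_le.1 (hK i y)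
  have hH : ∀ i, mgf (h i) (ρ i) (c / Real.sqrt n)
      ≤ Real.exp ((‖K - -K‖₊ / 2) ^ 2 * (c / Real.sqrt n) ^ 2 / 2) := fun i =>
    (hasSubgaussianMGF_of_mem_Icc_of_integral_eq_zero (hm i).aemeasurable (hb i) (h0 i)).mgf_le _
  calc ∏ i, mgf (h i) (ρ i) (c / Real.sqrt n)
      ≤ ∏ _i : Fin n, Real.exp ((‖K - -K‖₊ / 2) ^ 2 * (c / Real.sqrt n) ^ 2 / 2) :=
        Finset.prod_le_prod (fun i _ => mgf_nonneg) fun i _ => hH i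
    _ = Real.exp ((‖K - -K‖₊ / 2) ^ 2 * c ^ 2 / 2) := by
        rw [Finset.prod_const, Finset.card_univ, Fintype.card_fin, ← Real.exp_nat_mul, div_pow c,
          Real.sq_sqrt (Nat.cast_nonneg n)]
        congr 1
        field_simp

/-- **The partition function of a heterogeneous row on the diagonal**: `∏ᵢ M_{n,i}(c/√n) → e^{c²σ²/2}`
when `n⁻¹Σᵢ Var h_{n,i} → σ²`. [ours] -/
theorem heteroPi_prod_mgf_div_sqrt_tendsto {ρ : (n : ℕ) → Fin n → Measure Y}
    [∀ n i, IsProbabilityMeasure (ρ n i)] {h : (n : ℕ) → Fin n → Y → ℝ}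
    (hm : ∀ n i, Measurable (h n i)) {K : ℝ} (hK : ∀ n i y, |h n i y| ≤ K)
    (h0 : ∀ n i, ∫ y, h n i y ∂ρ n i = 0) {σ2 : ℝ}
    (hσ : Tendsto (fun n : ℕ => (∑ i, Var[h n i; ρ n i]) / n) atTop (𝓝 σ2)) (c : ℝ) :
    Tendsto (fun n : ℕ => ∏ i, mgf (h n i) (ρ n i) (c / Real.sqrt n)) atTop
      (𝓝 (Real.exp (c ^ 2 * σ2 / 2))) := by
  have hvarK : ∀ n i, Var[h n i; ρ n i] ≤ K ^ 2 := fun n i => by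
    have hb : ∀ᵐ y ∂ρ n i, h n i y ∈ Set.Icc (-K) K := ae_of_all _ fun y => abs_le.1 (hK n i y)
    exact (variance_le_sq_of_bounded hb (hm n i).aemeasurable).trans (le_of_eq (by ring))
  set m : (n : ℕ) → Fin n → ℝ := fun n i => mgf (h n i) (ρ n i) (c / Real.sqrt n) - 1 with hmdef
  have hu2 : ∀ n : ℕ, (c / Real.sqrt n) ^ 2 = c ^ 2 / n := fun n => by
    rw [div_pow, Real.sq_sqrt (Nat.cast_nonneg n)]
  have hu3 : ∀ n : ℕ, |c / Real.sqrt n| ^ 3 = |c| ^ 3 / (n * Real.sqrt n) := fun n => by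
    rw [abs_div, abs_of_nonneg (Real.sqrt_nonneg _), div_pow]
    have h3 : Real.sqrt n ^ 3 = (n : ℝ) * Real.sqrt n := by rw [pow_succ, Real.sq_sqrt (Nat.cast_nonneg n)]
    rw [h3]
  have hT : ∀ᶠ n : ℕ in atTop, ∀ i : Fin n,
      |m n i - c ^ 2 * Var[h n i; ρ n i] / (2 * n)| ≤ |c| ^ 3 * K ^ 3 / (n * Real.sqrt n) := by
    have hev : ∀ᶠ n : ℕ in atTop, (|c| * K) ^ 2 ≤ (n : ℝ) := by
      obtain ⟨N, hN⟩ := exists_nat_ge ((|c| * K) ^ 2)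
      exact (eventually_ge_atTop N).mono fun n hn => hN.trans (by exact_mod_cast hn)
    filter_upwards [hev, eventually_gt_atTop 0] with n hn hn0 i
    have hsn : 0 < Real.sqrt n := Real.sqrt_pos.2 (Nat.cast_pos.2 hn0)
    have hK0 : 0 ≤ K := (abs_nonneg _).trans (hK n i (Classical.choice (by
      by_contra hne; rw [not_nonempty_iff] at hne
      exact absurd (IsProbabilityMeasure.measure_univ (μ := ρ n i)) (by simp [Set.univ_eq_empty_iff.2 hne]))))
    have hu : |c / Real.sqrt n| * K ≤ 1 := by
      rw [abs_div, abs_of_nonneg hsn.le, div_mul_eq_mul_div, div_le_one hsn]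
      calc |c| * K = Real.sqrt ((|c| * K) ^ 2) := (Real.sqrt_sq (by positivity)).symm
        _ ≤ Real.sqrt n := Real.sqrt_le_sqrt hn
    have hb := abs_mgf_sub_taylor_le (ρ n i) (hm n i) (hK n i) (h0 n i) hu
    rw [hu2, hu3] at hb
    simp only [hmdef]
    convert hb using 2 <;> ring
  have hsum : Tendsto (fun n => ∑ i, m n i) atTop (𝓝 (c ^ 2 * σ2 / 2)) := by
    have hmain : Tendsto (fun n : ℕ => c ^ 2 / 2 * ((∑ i, Var[h n i; ρ n i]) / n)) atTop
        (𝓝 (c ^ 2 * σ2 / 2)) := by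
      have := hσ.const_mul (c ^ 2 / 2); convert this using 2; ring
    have hrem : Tendsto (fun n : ℕ => ∑ i, m n i - c ^ 2 / 2 * ((∑ i, Var[h n i; ρ n i]) / n)) atTop
        (𝓝 0) := by
      have hup : Tendsto (fun n : ℕ => |c| ^ 3 * K ^ 3 / Real.sqrt n) atTop (𝓝 0) := by
        have := (tendsto_inv_atTop_zero.comp
          (Real.tendsto_sqrt_atTop.comp tendsto_natCast_atTop_atTop)).const_mul (|c| ^ 3 * K ^ 3)
        simpa [div_eq_mul_inv] using this
      refine squeeze_zero_norm' ?_ hup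
      filter_upwards [hT, eventually_gt_atTop 0] with n hn hn0
      have hV' : (0 : ℝ) < n := Nat.cast_pos.2 hn0
      have e : c ^ 2 / 2 * ((∑ i, Var[h n i; ρ n i]) / n) = ∑ i, c ^ 2 * Var[h n i; ρ n i] / (2 * n) := by
        rw [Finset.sum_div, Finset.mul_sum]
        exact Finset.sum_congr rfl fun i _ => by ring
      rw [e, ← Finset.sum_sub_distrib, Real.norm_eq_abs]
      calc |∑ i, (m n i - c ^ 2 * Var[h n i; ρ n i] / (2 * n))|
          ≤ ∑ i, |m n i - c ^ 2 * Var[h n i; ρ n i] / (2 * n)| := Finset.abs_sum_le_sum_abs _ _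
        _ ≤ ∑ _i : Fin n, |c| ^ 3 * K ^ 3 / (n * Real.sqrt n) := Finset.sum_le_sum fun i _ => hn i
        _ = |c| ^ 3 * K ^ 3 / Real.sqrt n := by
            rw [Finset.sum_const, Finset.card_univ, Fintype.card_fin, nsmul_eq_mul]
            field_simp
    have := hmain.add hrem
    simpa using this
  set ε : ℕ → ℝ := fun n => c ^ 2 * K ^ 2 / (2 * n) + |c| ^ 3 * K ^ 3 / (n * Real.sqrt n) with hε
  have hmle : ∀ᶠ n : ℕ in atTop, ∀ i : Fin n, |m n i| ≤ ε n := by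
    filter_upwards [hT, eventually_gt_atTop 0] with n hn hn0 i
    have hV' : (0 : ℝ) < n := Nat.cast_pos.2 hn0
    have h2 : |c ^ 2 * Var[h n i; ρ n i] / (2 * n)| ≤ c ^ 2 * K ^ 2 / (2 * n) := by
      rw [abs_of_nonneg (div_nonneg (mul_nonneg (sq_nonneg c) (variance_nonneg _ _)) (by positivity))]
      -- `Var ≤ K²`
      have := hvarK n i
      gcongr
    calc |m n i| = |(m n i - c ^ 2 * Var[h n i; ρ n i] / (2 * n)) + c ^ 2 * Var[h n i; ρ n i] / (2 * n)| := by
          rw [sub_add_cancel]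
      _ ≤ |m n i - c ^ 2 * Var[h n i; ρ n i] / (2 * n)| + |c ^ 2 * Var[h n i; ρ n i] / (2 * n)| :=
          abs_add_le _ _
      _ ≤ |c| ^ 3 * K ^ 3 / (n * Real.sqrt n) + c ^ 2 * K ^ 2 / (2 * n) := add_le_add (hn i) h2
      _ = ε n := by simp only [hε]; ring
  have hε0 : Tendsto ε atTop (𝓝 0) := by
    have hV : Tendsto (fun n : ℕ => (n : ℝ)) atTop atTop := tendsto_natCast_atTop_atTop
    have hsV : Tendsto (fun n : ℕ => (n : ℝ) * Real.sqrt n) atTop atTop :=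
      hV.atTop_mul_atTop₀ (Real.tendsto_sqrt_atTop.comp hV)
    have a := (tendsto_const_nhds (x := c ^ 2 * K ^ 2)).div_atTop (hV.const_mul_atTop two_pos)
    have b := (tendsto_const_nhds (x := |c| ^ 3 * K ^ 3)).div_atTop hsV
    simpa [hε] using a.add b
  have hsq : Tendsto (fun n => ∑ i, m n i ^ 2) atTop (𝓝 0) := by
    have hVε : Tendsto (fun n : ℕ => (n : ℝ) * ε n ^ 2) atTop (𝓝 0) := by
      have e : ∀ n : ℕ, 0 < n → (n : ℝ) * ε n ^ 2
          = (c ^ 2 * K ^ 2 / 2 + |c| ^ 3 * K ^ 3 / Real.sqrt n) ^ 2 / n := fun n hn => by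
        have hV' : (0 : ℝ) < n := Nat.cast_pos.2 hn
        have hsV : 0 < Real.sqrt n := Real.sqrt_pos.2 hV'
        simp only [hε]
        field_simp
      have hlim : Tendsto (fun n : ℕ => (c ^ 2 * K ^ 2 / 2 + |c| ^ 3 * K ^ 3 / Real.sqrt n) ^ 2 / n)
          atTop (𝓝 0) := by
        have hc : Tendsto (fun n : ℕ => c ^ 2 * K ^ 2 / 2 + |c| ^ 3 * K ^ 3 / Real.sqrt n) atTop
            (𝓝 (c ^ 2 * K ^ 2 / 2 + 0)) := by
          refine tendsto_const_nhds.add ?_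
          have := (tendsto_inv_atTop_zero.comp
            (Real.tendsto_sqrt_atTop.comp tendsto_natCast_atTop_atTop)).const_mul (|c| ^ 3 * K ^ 3)
          simpa [div_eq_mul_inv] using this
        exact (hc.pow 2).div_atTop tendsto_natCast_atTop_atTop
      exact hlim.congr' ((eventually_gt_atTop 0).mono fun n hn => (e n hn).symm)
    refine squeeze_zero' (Filter.Eventually.of_forall fun n => Finset.sum_nonneg fun i _ => sq_nonneg _)
      ?_ hVε
    filter_upwards [hmle] with n hn
    calc ∑ i, m n i ^ 2 ≤ ∑ _i : Fin n, ε n ^ 2 := Finset.sum_le_sum fun i _ => by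
          have := hn i
          rw [← sq_abs]
          exact pow_le_pow_left₀ (abs_nonneg _) this 2
      _ = n * ε n ^ 2 := by simp
  have hsmall : ∀ᶠ n in atTop, ∀ i : Fin n, |m n i| ≤ 1 / 2 := by
    filter_upwards [hmle, (Metric.tendsto_nhds.1 hε0) (1 / 2) (by norm_num)] with n hn hε2 i
    have : |ε n| < 1 / 2 := by simpa [Real.dist_eq] using hε2
    exact (hn i).trans (le_of_lt (lt_of_abs_lt this))
  have key := tendsto_finprod_one_add_rexp hsum hsq hsmall
  refine key.congr fun n => Finset.prod_congr rfl fun i _ => ?_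
  simp [hmdef]

end HeteroRows

/-! ## §2 The universality theorem for heterogeneous rows -/

section HeteroUniversality

variable {Y : Type*} {mY : MeasurableSpace Y} {ρ : (n : ℕ) → Fin n → Measure Y}
  [∀ n i, IsProbabilityMeasure (ρ n i)] {h : (n : ℕ) → Fin n → Y → ℝ}

/-- **LOG-NORMAL UNIVERSALITY, HETEROGENEOUS BLOCKS.**  Independent blocks with laws `ρ_{n,i}`
and bounded centred statistics `h_{n,i}` (`|h_{n,i}| ≤ K`), average variance `n⁻¹Σᵢ Var h_{n,i} → σ²`,
coupling `c`: the equilibrium acceptance of `⊗ᵢρ_{n,i}`-proposals against the tilt by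
`(c/√n)Σᵢ h_{n,i}(yᵢ)` converges to `∫∫ min(e^x, e^y) dN(−s/2, s)²`, `s = c²σ²`. [ours] -/
theorem heteroPi_meanAccept_tendsto (hm : ∀ n i, Measurable (h n i)) {K : ℝ}
    (hK : ∀ n i y, |h n i y| ≤ K) (h0 : ∀ n i, ∫ y, h n i y ∂ρ n i = 0) {σ2 : ℝ}
    (hσ : Tendsto (fun n : ℕ => (∑ i, Var[h n i; ρ n i]) / n) atTop (𝓝 σ2)) (c : ℝ) :
    Tendsto (fun n : ℕ =>
        (∫ x, ∫ y, min (Real.exp (c / Real.sqrt n * ∑ i, h n i (x i)))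
              (Real.exp (c / Real.sqrt n * ∑ i, h n i (y i)))
            ∂(Measure.pi (ρ n)) ∂(Measure.pi (ρ n)))
          / ∫ x, Real.exp (c / Real.sqrt n * ∑ i, h n i (x i)) ∂(Measure.pi (ρ n)))
      atTop (𝓝 (∫ x, ∫ y, min (Real.exp x) (Real.exp y)
        ∂(noiseLaw (c ^ 2 * σ2).toNNReal) ∂(noiseLaw (c ^ 2 * σ2).toNNReal))) := by
  set v : ℝ := σ2 with hv
  have hv0 : 0 ≤ v :=
    ge_of_tendsto' hσ fun n => div_nonneg (Finset.sum_nonneg fun i _ => variance_nonneg _ _)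
      (Nat.cast_nonneg n)
  have hga : ∀ n i, AEMeasurable (h n i) (ρ n i) := fun n i => (hm n i).aemeasurable
  have hgb : ∀ n i, ∀ᵐ y ∂ρ n i, h n i y ∈ Set.Icc (-K) K :=
    fun n i => ae_of_all _ fun y => abs_le.1 (hK n i y)
  have hvarK : ∀ n i, Var[h n i; ρ n i] ≤ K ^ 2 := fun n i =>
    (variance_le_sq_of_bounded (hgb n i) (hga n i)).trans (le_of_eq (by ring))
  have hvK : v ≤ K ^ 2 := by
    refine le_of_tendsto' hσ fun n => ?_
    rcases Nat.eq_zero_or_pos n with hn | hn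
    · subst hn; simp; positivity
    · rw [div_le_iff₀ (Nat.cast_pos.2 hn)]
      calc ∑ i, Var[h n i; ρ n i] ≤ ∑ _i : Fin n, K ^ 2 := Finset.sum_le_sum fun i _ => hvarK n i
        _ = K ^ 2 * n := by simp [mul_comm]
  set P : (n : ℕ) → Measure (Fin n → Y) := fun n => Measure.pi (ρ n) with hP
  set S : (n : ℕ) → (Fin n → Y) → ℝ := fun n y => (Real.sqrt n)⁻¹ * ∑ i, h n i (y i) with hS
  have hSm : ∀ n, Measurable (S n) := fun n =>
    (Finset.measurable_sum _ fun i _ => (hm n i).comp (measurable_pi_apply i)).const_mul _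
  -- the laws `μₙ` of `Sₙ` and the Gaussian limit law
  haveI hPn : ∀ n, IsProbabilityMeasure ((P n).map (S n)) := fun n =>
    Measure.isProbabilityMeasure_map (hSm n).aemeasurable
  set μs : ℕ → ProbabilityMeasure ℝ := fun n => ⟨(P n).map (S n), hPn n⟩ with hμs
  set μ : ProbabilityMeasure ℝ := ⟨gaussianReal 0 v.toNNReal, inferInstance⟩ with hμ
  -- (1) the central limit theorem for the rows
  have hclt : Tendsto μs atTop (𝓝 μ) := by
    have hZ : HasLaw (id : ℝ → ℝ) (gaussianReal 0 v.toNNReal) (gaussianReal 0 v.toNNReal) :=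
      ⟨aemeasurable_id, Measure.map_id⟩
    have h := (heteroPi_tendstoInDistribution (P' := gaussianReal 0 v.toNNReal)
      hm hK h0 hσ hZ).tendsto
    simp only [Measure.map_id] at h
    convert h using 1
  -- exponential integrability of the laws
  have hexp : ∀ n (t : ℝ), Integrable (fun u => Real.exp (t * u)) ((μs n : Measure ℝ)) := by
    intro n t
    have hae : ∀ᵐ u ∂((P n).map (S n)), u ∈ Set.Icc (-(Real.sqrt n * K)) (Real.sqrt n * K) :=
      (ae_map_iff (hSm n).aemeasurable
        (p := fun u => u ∈ Set.Icc (-(Real.sqrt n * K)) (Real.sqrt n * K)) measurableSet_Icc).2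
        (ae_of_all _ fun y => heteroPi_inv_sqrt_mul_sum_mem_Icc (hK n) y)
    exact integrable_exp_mul_of_mem_Icc (X := id) aemeasurable_id hae
  have hexpP : ∀ n (t : ℝ), Integrable (fun u => Real.exp (t * u)) ((P n).map (S n)) :=
    fun n t => hexp n t
  have hexpG : ∀ t : ℝ, Integrable (fun u => Real.exp (t * u)) (μ : Measure ℝ) := fun t => by
    change Integrable (fun u => Real.exp (t * id u)) (gaussianReal 0 v.toNNReal)
    exact (integrable_exp_mul_gaussianReal (μ := 0) (v := v.toNNReal) t)
  -- (2) the numerator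
  set C : ℝ := Real.exp ((‖K - -K‖₊ / 2) ^ 2 * (2 * c) ^ 2 / 2) with hC
  have hnum : Tendsto (fun n => ∫ z, min (Real.exp (c * z.1)) (Real.exp (c * z.2))
        ∂(((μs n : Measure ℝ)).prod (μs n))) atTop
      (𝓝 (∫ z, min (Real.exp (c * z.1)) (Real.exp (c * z.2)) ∂((μ : Measure ℝ).prod μ))) := by
    refine tendsto_integral_prod_of_tendsto hclt (by fun_prop)
      (fun z => (lt_min (Real.exp_pos _) (Real.exp_pos _)).le) (C := C) ?_ ?_ ?_ ?_
    · intro n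
      exact (min_exp_prod_facts (μs n : Measure ℝ) c (hexp n c)
        (hexp n (2 * c))).2.1
    · intro n
      refine (min_exp_prod_facts (μs n : Measure ℝ) c (hexp n c)
        (hexp n (2 * c))).2.2.trans ?_
      change ∫ u, Real.exp (2 * c * u) ∂((P n).map (S n)) ≤ C
      rw [heteroPi_integral_exp_mul_map_inv_sqrt_mul_sum (ρ n) (hm n) (2 * c)]
      exact heteroPi_prod_mgf_div_sqrt_le (ρ n) (hm n) (hK n) (h0 n) (2 * c)
    · exact (min_exp_prod_facts (μ : Measure ℝ) c (hexpG c)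
        (hexpG (2 * c))).2.1
    · refine (min_exp_prod_facts (μ : Measure ℝ) c (hexpG c)
        (hexpG (2 * c))).2.2.trans ?_
      change ∫ u, Real.exp (2 * c * u) ∂(gaussianReal 0 v.toNNReal) ≤ C
      have hm := mgf_gaussianReal (p := gaussianReal 0 v.toNNReal) (X := id) (μ := 0) (v := v.toNNReal)
        Measure.map_id (2 * c)
      simp only [mgf, id_eq] at hm
      rw [show (fun u : ℝ => Real.exp (2 * c * u)) = fun u => Real.exp ((2 * c) * u) from rfl, hm,
        Real.coe_toNNReal v hv0, hC]
      apply Real.exp_le_exp.2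
      have h1 : (‖K - -K‖₊ : ℝ) / 2 = |K| := by
        rw [coe_nnnorm, Real.norm_eq_abs, sub_neg_eq_add, ← two_mul, abs_mul, abs_two]; ring
      rw [h1, sq_abs, zero_mul, zero_add]
      nlinarith [sq_nonneg c]
  -- (3) the denominator: `∏ᵢ M_{n,i}(c/√n) → e^{c²σ²/2}`
  have hden : Tendsto (fun n : ℕ => ∫ x, Real.exp (c / Real.sqrt n * ∑ i, h n i (x i)) ∂(P n)) atTop
      (𝓝 (Real.exp (c ^ 2 * v / 2))) := by
    have h := heteroPi_prod_mgf_div_sqrt_tendsto hm hK h0 hσ c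
    refine h.congr fun n => ?_
    rw [heteroPi_integral_exp_mul_sum (ρ n) (hm n)]
  -- (4) assemble
  have hnum' : Tendsto (fun n : ℕ => ∫ x, ∫ y, min (Real.exp (c / Real.sqrt n * ∑ i, h n i (x i)))
        (Real.exp (c / Real.sqrt n * ∑ i, h n i (y i))) ∂(P n) ∂(P n)) atTop
      (𝓝 (∫ z, min (Real.exp (c * z.1)) (Real.exp (c * z.2)) ∂((μ : Measure ℝ).prod μ))) := by
    refine hnum.congr fun n => ?_
    have e : ∀ x : Fin n → Y, c / Real.sqrt n * ∑ i, h n i (x i) = c * S n x := fun x => by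
      simp only [hS]; ring
    simp_rw [e]
    exact (integral_integral_min_exp_eq_integral_prod_map (P n) (hSm n) c (hexpP n c)
      (hexpP n (2 * c))).symm
  have hlim := hnum'.div hden (Real.exp_pos _).ne'
  -- (5) identify the limit with the log-normal acceptance law
  have hprodA : ∫ z, min (Real.exp (c * z.1)) (Real.exp (c * z.2)) ∂((μ : Measure ℝ).prod μ)
      = ∫ x, ∫ y, min (Real.exp (c * x)) (Real.exp (c * y)) ∂(gaussianReal 0 v.toNNReal)
          ∂(gaussianReal 0 v.toNNReal) :=
    integral_prod _ (min_exp_prod_facts (μ : Measure ℝ) c (hexpG c) (hexpG (2 * c))).1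
  rw [hprodA] at hlim
  set s : ℝ≥0 := (c ^ 2 * v).toNNReal with hs
  have hcv : 0 ≤ c ^ 2 * v := by positivity
  have hsR : (s : ℝ) = c ^ 2 * v := Real.coe_toNNReal _ hcv
  -- the log-normal law as an affine image of `N(0, v)`
  have hφ : noiseLaw s
      = (gaussianReal 0 v.toNNReal).map (fun u => c * u + (-(c ^ 2 * v / 2))) := by
    rw [show (fun u : ℝ => c * u + (-(c ^ 2 * v / 2))) = (fun u => u + (-(c ^ 2 * v / 2))) ∘ (fun u => c * u)
        from rfl,
      ← Measure.map_map (measurable_add_const _) (measurable_const_mul c), gaussianReal_map_const_mul,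
      gaussianReal_map_add_const, noiseLaw, hsR]
    congr 1
    · ring
    · ext
      push_cast
      rw [Real.coe_toNNReal _ hcv, Real.coe_toNNReal _ hv0]
  have hF2c : Continuous fun z : ℝ × ℝ => min (Real.exp z.1) (Real.exp z.2) := by fun_prop
  have hEq : (∫ x, ∫ y, min (Real.exp (c * x)) (Real.exp (c * y)) ∂(gaussianReal 0 v.toNNReal)
        ∂(gaussianReal 0 v.toNNReal)) / Real.exp (c ^ 2 * v / 2)
      = ∫ x, ∫ y, min (Real.exp x) (Real.exp y) ∂(noiseLaw s) ∂(noiseLaw s) := by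
    rw [hφ, integral_map (by fun_prop)
      (hF2c.stronglyMeasurable.integral_prod_right').aestronglyMeasurable]
    have inner : ∀ x : ℝ, ∫ y, min (Real.exp x) (Real.exp y)
          ∂((gaussianReal 0 v.toNNReal).map (fun u => c * u + (-(c ^ 2 * v / 2))))
        = ∫ u, min (Real.exp x) (Real.exp (c * u + (-(c ^ 2 * v / 2)))) ∂(gaussianReal 0 v.toNNReal) :=
      fun x => integral_map (by fun_prop) (by fun_prop)
    simp_rw [inner]
    have pt : ∀ u u' : ℝ, min (Real.exp (c * u + (-(c ^ 2 * v / 2)))) (Real.exp (c * u' + (-(c ^ 2 * v / 2))))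
        = min (Real.exp (c * u)) (Real.exp (c * u')) * Real.exp (-(c ^ 2 * v / 2)) := fun u u' => by
      rw [Real.exp_add, Real.exp_add, min_mul_of_nonneg _ _ (Real.exp_pos _).le]
    simp_rw [pt, integral_mul_const]
    rw [Real.exp_neg, div_eq_mul_inv]
  rw [hEq] at hlim
  exact hlim



end HeteroUniversality

end Summit.Ventures.LatticeQCDFlow.Theory2

end
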